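import Summits.QuantumFields.BalabanUV.T4Continuum.Support.VariationalLeaves
import Summits.QuantumFields.BalabanUV.T4Continuum.Support.VariationalOpNorm
import Summits.QuantumFields.BalabanUV.T4Continuum.Spine.CovariantAveragingTower

/-!
# T⁴ programme, spine node NE2 (U1a), lane P2 — THE VARIATIONAL ROUTE WITH ADDITIVE ONE-STEP DEFECTS
# (a located correction of the tier-⁺ hypothesis shape of `t4/skeletons/NE2-t4-ne2-p2.md` v0.4, and the shape v0.5 uses;
# cell `pub-balaban`, `HOME/BINDER-OWNERS.md` row NE2 co-owner #2, lineage t4-ne2-p2 gen 10)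

HONEST FRAMING (T4-DAG p. 1).  Rung (B)+1 of the cell = existence AND uniqueness of the ε → 0 limit of gauge-invariant observables
on a FIXED finite torus T⁴ — NOT infinite volume, NOT a mass gap, NOT the Clay problem.  Node NE2 (the η-rate of the LINEAR theory)
is NOT IN PRINT (cell GAPS G-t4-U1a-1) and is NOT proved here.  This file is lattice-theoretic ALGEBRA only (arbitrary nonnegative
"actions" and "averagings", as in `Support/VariationalTransfer`), plus one reading into the operator norm.  No `sorry`; axioms ⊆
{propext, Classical.choice, Quot.sound}; nothing printed is a hypothesis.  HONEST DEPENDENCY (cell, verbatim): continuum YM on T⁴ ⇐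
BetaPertH ∧ nine spine estimates (0/9 proved); BetaPertH ⇐ (D1) ∧ (D4) ∧ CAP+tail; G-an2-4 gates asym, D1 and NE2/3/4.

WHY THIS FILE (the located point).  Row NE2's consumer currency is the OPERATOR NORM of the increments of the unit-lattice effective
actions, `Spine/CovariantAveragingTower.OneStepAveragedLaw (fun _ ↦ 1) 1 X e : ‖X_{k+1} − X_k‖ ≤ e_k` — an ABSOLUTE bound.  The tier-0
spine (`VariationalTransfer.step_sandwich`) and the v0.4 background shape `VariationalLeaves.CovariantStepLaws D μ ε` are RELATIVE
(multiplicative factors `1 + μ`, `1 + ε`), which is harmless at `U = 1` (there the Federbush factor is EXACTLY 1) but too strong with a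
background: the field `CovariantStepLaws.federbush : ∀ A′, Sc (Q₁ A′) ≤ (1 + μ)·Sf A′` forces `Sf A′ = 0 ⇒ Sc (Q₁ A′) = 0`, i.e. every
`U′`-covariantly-constant fine section must average to a `Ū′`-covariantly-constant coarse section — false as soon as the coarse
transporters `Ū′(y, y′)` differ from the straight fine transports `U′(Γ_{y,y′})` on a flat section (a transport MISMATCH `m > 0` with
`Sf = 0`), for EVERY finite `μ`.  What the covariant Stokes/Jensen argument actually gives is ADDITIVE: `Sc (Q₁ A′) ≤ (√(Sf A′) + √D)²`
with a defect `D ∝ m²·‖A′‖²` — and what the consumer needs is additive too.  So this file re-runs the route with ADDITIVE one-step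
defects evaluated AT THE TWO MINIMISERS ONLY (the contraction mechanism is unchanged: no comparison on lattice-scale fields is ever
made), and records that the relative shape is the special case `e = μ·Δ_{k+1}(B)`, `e′ = ε·Δ_k(B)` (§3).

CONTENTS.  §1 `blockSpin_lower_additive`, `blockSpin_upper_additive`, `step_additive`, `abs_step_le` (abstract).  §3
`additive_of_stepLaws` (the relative shape `CovariantStepLaws` ⟹ the additive bracket).  §4 the reading into the consumer's currency:
`opNorm_sub_le_of_form_abs` (Hermitian `X₀, X₁` with `|re v†(X₁ − X₀)v| ≤ e·Σ|v_i|²` ⟹ `‖X₁ − X₀‖ ≤ e`) and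
`oneStepAveragedLaw_of_forms` (per-level form bounds ⟹ `OneStepAveragedLaw (fun _ ↦ 1) 1 X e`).  The named additive hypothesis
SHAPE `PairDefects` (the background tier's leaves as fields) is the sibling definition module `Support/VariationalPairShape` (§2 there).
-/

namespace Summit.QuantumFields.BalabanUV.T4Continuum.VariationalAdditive

open Summit.QuantumFields.BalabanUV.T4Continuum.VariationalTransfer
open Summit.QuantumFields.BalabanUV.T4Continuum.VariationalLeaves (CovariantStepData CovariantStepLaws covariant_step_diff)
open Summit.QuantumFields.BalabanUV.T4Continuum.CovariantAveragingTower (OneStepAveragedLaw)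

variable {V W Z : Type*}

/-! ## §1 Additive transfer through the block-spin map (abstract) -/

section additive

/-- **ADDITIVE LOWER TRANSFER (Federbush direction), AT THE FINE MINIMISER ONLY**: if `A₀′` minimises the fine action `Sf` on the
composite fibre over `B` and averaging increases the action of `A₀′` by at most `e`, `S⁰ (Q₁ A₀′) ≤ Sf A₀′ + e`, then
`Δ_k(B) ≤ Δ_{k+1}(B) + e` (`Δ_k := T_{Q_k} S⁰`, `Δ_{k+1} := T_{Q_k∘Q₁} Sf`). [folklore] -/
theorem blockSpin_lower_additive {Qk : W → Z} {Q₁ : V → W} {B : Z} {S0 : W → ℝ} {Sf : V → ℝ} {e : ℝ}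
    (hS0 : ∀ A₁, 0 ≤ S0 A₁) (hSf : ∀ A', 0 ≤ Sf A')
    {A₀' : V} (hA₀' : Qk (Q₁ A₀') = B) (hmin' : ∀ A', Qk (Q₁ A') = B → Sf A₀' ≤ Sf A')
    (hF : S0 (Q₁ A₀') ≤ Sf A₀' + e) :
    blockSpin Qk S0 B ≤ blockSpin (Qk ∘ Q₁) Sf B + e := by
  have hval : blockSpin (Qk ∘ Q₁) Sf B = Sf A₀' :=
    blockSpin_eq_of_isMin (Q := Qk ∘ Q₁) hSf (by simpa using hA₀') (fun A hA => hmin' A (by simpa using hA))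
  rw [hval]
  exact (blockSpin_le hS0 (A := Q₁ A₀') hA₀').trans hF

/-- **ADDITIVE UPPER TRANSFER, AT THE COARSE MINIMISER ONLY**: if `A₀` minimises `S⁰` on the `Q`-fibre of `B` and
`S¹ A₀ ≤ S⁰ A₀ + e′`, then `T_Q S¹ (B) ≤ T_Q S⁰ (B) + e′`. [folklore] -/
theorem blockSpin_upper_additive {Q : V → W} {S0 S1 : V → ℝ} {B : W} {e' : ℝ} (hS1 : ∀ A, 0 ≤ S1 A)
    (hS0 : ∀ A, 0 ≤ S0 A) {A₀ : V} (hA₀ : Q A₀ = B) (hmin : ∀ A, Q A = B → S0 A₀ ≤ S0 A)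
    (hc : S1 A₀ ≤ S0 A₀ + e') :
    blockSpin Q S1 B ≤ blockSpin Q S0 B + e' := by
  rw [blockSpin_eq_of_isMin hS0 hA₀ hmin]
  exact (blockSpin_le hS1 hA₀).trans hc

/-- **THE ADDITIVE ONE-STEP BRACKET** at one level: (Federbush + `e` at the fine minimiser `A₀′`) ∧ (one-step consistency + `e′`
at the coarse minimiser `A₀`) ⟹ `Δ_k(B) ≤ Δ_{k+1}(B) + e` and `Δ_{k+1}(B) ≤ Δ_k(B) + e′` (composition law
[Balaban1984PropagatorsI] (1.16)–(1.18): `Δ_{k+1} = T_{Q_k}(T_{Q₁} S_f)`, kernel `blockSpin_comp`). [folklore] -/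
theorem step_additive {Qk : W → Z} {Q₁ : V → W} {S0 : W → ℝ} {Sf : V → ℝ} {B : Z} {e e' : ℝ}
    (hQ₁ : Function.Surjective Q₁) (hS0 : ∀ A₁, 0 ≤ S0 A₁) (hSf : ∀ A', 0 ≤ Sf A')
    {A₀ : W} (hA₀ : Qk A₀ = B) (hmin : ∀ A₁, Qk A₁ = B → S0 A₀ ≤ S0 A₁)
    {A₀' : V} (hA₀' : Qk (Q₁ A₀') = B) (hmin' : ∀ A', Qk (Q₁ A') = B → Sf A₀' ≤ Sf A')
    (hF : S0 (Q₁ A₀') ≤ Sf A₀' + e) (hc : blockSpin Q₁ Sf A₀ ≤ S0 A₀ + e') :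
    blockSpin Qk S0 B ≤ blockSpin (Qk ∘ Q₁) Sf B + e ∧
      blockSpin (Qk ∘ Q₁) Sf B ≤ blockSpin Qk S0 B + e' := by
  refine ⟨blockSpin_lower_additive hS0 hSf hA₀' hmin' hF, ?_⟩
  rw [blockSpin_comp hQ₁ hSf]
  exact blockSpin_upper_additive (fun _ => blockSpin_nonneg' hSf) hS0 hA₀ hmin hc

/-- the bracket in absolute-value form: `|Δ_{k+1}(B) − Δ_k(B)| ≤ max e e′`. [folklore] -/
theorem abs_step_le {Qk : W → Z} {Q₁ : V → W} {S0 : W → ℝ} {Sf : V → ℝ} {B : Z} {e e' : ℝ}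
    (hQ₁ : Function.Surjective Q₁) (hS0 : ∀ A₁, 0 ≤ S0 A₁) (hSf : ∀ A', 0 ≤ Sf A')
    {A₀ : W} (hA₀ : Qk A₀ = B) (hmin : ∀ A₁, Qk A₁ = B → S0 A₀ ≤ S0 A₁)
    {A₀' : V} (hA₀' : Qk (Q₁ A₀') = B) (hmin' : ∀ A', Qk (Q₁ A') = B → Sf A₀' ≤ Sf A')
    (hF : S0 (Q₁ A₀') ≤ Sf A₀' + e) (hc : blockSpin Q₁ Sf A₀ ≤ S0 A₀ + e') :
    |blockSpin (Qk ∘ Q₁) Sf B - blockSpin Qk S0 B| ≤ max e e' := by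
  obtain ⟨h₁, h₂⟩ := step_additive hQ₁ hS0 hSf hA₀ hmin hA₀' hmin' hF hc
  rw [abs_le]
  constructor
  · linarith [le_max_left e e']
  · linarith [le_max_right e e']

end additive

/-! ## §3 The relative shape is the special case `e·q B = μ·Δ_{k+1}(B)`, `e′·q B = ε·Δ_k(B)` -/

/-- relative (v0.4) ⟹ additive (v0.5): under `CovariantStepLaws D μ ε` the one-sided differences are bounded by `μ·Δ_{k+1}(B)` and
`ε·Δ_k(B)` (`VariationalLeaves.covariant_step_diff`) — the additive bracket with data-dependent defects.  (The converse fails: see the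
file header.) [folklore] -/
theorem additive_of_stepLaws {D : CovariantStepData V W Z} {μ ε : ℝ} (h : CovariantStepLaws D μ ε) (B : Z) :
    blockSpin D.Qk D.Sc B ≤ blockSpin (D.Qk ∘ D.Q₁) D.Sf B + μ * blockSpin (D.Qk ∘ D.Q₁) D.Sf B ∧
      blockSpin (D.Qk ∘ D.Q₁) D.Sf B ≤ blockSpin D.Qk D.Sc B + ε * blockSpin D.Qk D.Sc B := by
  obtain ⟨h₁, h₂⟩ := covariant_step_diff h B
  constructor <;> linarith

/-! ## §4 Reading into the consumer's currency (operator norm on the unit lattice) -/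

section opnorm

open scoped Matrix ComplexConjugate Matrix.Norms.L2Operator
open Summit.QuantumFields.BalabanUV.T4Continuum.VariationalOpNorm (opNorm_le_of_quadForm)

variable {ι : Type*} [Fintype ι] [DecidableEq ι]

/-- **ADDITIVE FORM BOUND ⟹ OPERATOR-NORM BOUND**: Hermitian `X₀, X₁` with `|re v†(X₁ − X₀)v| ≤ e·Σ|v_i|²` for every `v` satisfy
`‖X₁ − X₀‖ ≤ e`.  (For the route: `re v†X_k v = Δ_k(v)`, the two one-sided bounds of `step_additive` with defects `e·Σ|v_i|²`.)
[folklore] -/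
theorem opNorm_sub_le_of_form_abs {X₀ X₁ : Matrix ι ι ℂ} (h₀ : X₀.IsHermitian) (h₁ : X₁.IsHermitian) {e : ℝ} (he : 0 ≤ e)
    (hup : ∀ v : ι → ℂ, (star v ⬝ᵥ (X₁ *ᵥ v)).re ≤ (star v ⬝ᵥ (X₀ *ᵥ v)).re + e * ∑ i, ‖v i‖ ^ 2)
    (hlow : ∀ v : ι → ℂ, (star v ⬝ᵥ (X₀ *ᵥ v)).re ≤ (star v ⬝ᵥ (X₁ *ᵥ v)).re + e * ∑ i, ‖v i‖ ^ 2) :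
    ‖X₁ - X₀‖ ≤ e := by
  refine opNorm_le_of_quadForm (h₁.sub h₀) he fun v => ?_
  rw [Matrix.sub_mulVec, dotProduct_sub, Complex.sub_re, abs_le]
  constructor
  · linarith [hlow v]
  · linarith [hup v]

/-- **PER-LEVEL ADDITIVE FORM BOUNDS ⟹ `OneStepAveragedLaw (fun _ ↦ 1) 1 X e`** (the effective actions live on the fixed unit
lattice, so the averaging tower is the identity and `r = 1`): row NE2's wall SHAPE for the effective-action species from the two
one-sided form inequalities at each level. [folklore] -/
theorem oneStepAveragedLaw_of_forms (X : ℕ → Matrix ι ι ℂ) (hX : ∀ k, (X k).IsHermitian) (e : ℕ → ℝ) (he : ∀ k, 0 ≤ e k)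
    (hup : ∀ k (v : ι → ℂ), (star v ⬝ᵥ (X (k + 1) *ᵥ v)).re ≤ (star v ⬝ᵥ (X k *ᵥ v)).re + e k * ∑ i, ‖v i‖ ^ 2)
    (hlow : ∀ k (v : ι → ℂ), (star v ⬝ᵥ (X k *ᵥ v)).re ≤ (star v ⬝ᵥ (X (k + 1) *ᵥ v)).re + e k * ∑ i, ‖v i‖ ^ 2) :
    OneStepAveragedLaw (ι := fun _ => ι) (fun _ => (1 : Matrix ι ι ℂ)) 1 X e := by
  intro k
  simp only [Matrix.conjTranspose_one, Matrix.mul_one, Complex.ofReal_one, inv_one, one_smul, one_mul]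
  exact opNorm_sub_le_of_form_abs (hX k) (hX (k + 1)) (he k) (hup k) (hlow k)

end opnorm

end Summit.QuantumFields.BalabanUV.T4Continuum.VariationalAdditive
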